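import Summits.Ventures.LatticeQCDFlow.TrivializingMaps.WilsonLinkLocality
import Literature.MathematicalPhysics.QuantumFieldTheory.WilsonFlow
import HarnessLib

/-!
# The staple sum: the link-local Wilson action in staple form, `∑_{p ∋ e} (N − Re tr ρ(U_p)) = 2(d−1)N − Re tr (ρ(U_e) R_e(U))`

HONEST FRAMING: exact (Metropolis-corrected) sampling algorithms for lattice gauge theory;
figures of merit are autocorrelation/cost numbers at stated couplings and volumes; no
continuum-physics claim.

Venture `LatticeQCDFlow` (cell pub-lqcd), sub-topic `Scoring`; FANOUT row 16 (`su2-base`: the 4-d `SU(2)`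
baselines `1HB+nOR` / HMC are scored on `τ_int(Q)` with TWO charge definitions — the clover charge after Wilson
flow and the α-rounded charge after COOLING; both smoothings, and every local `SU(2)` update of the `E1` arm,
are driven by the STAPLE SUM of a link).  NEW WORK of the cell (placement rule): lattice bookkeeping over the
tree's torus `GaugeConfig d L G` / `plaquetteHolonomy` / `wilsonAction ρ` (`ConstructiveQFTWave0`), the link-local
action `linkAction ρ e = ∑_{p ∋ e} (N − Re tr ρ(U_p))` and its fibre lemmas (`TrivializingMaps/WilsonLinkLocality`, which
lists the exact count `#plaqThrough e = 2(d−1)` as NOT CLAIMED — it is proved here), and the Literature Wilson flow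
(`QuantumFieldTheory/WilsonFlow`: `plaquetteLoopSum = Ω_{x,μ}`).  Nothing is cited as a fact; no number.  Printed
counterparts, NAMED ONLY: Creutz, Phys. Rev. D 21 (1980) 2308 §III (the "sum of staples" of a link); Morningstar–Peardon
2004 eq. (1) (`C_μ(x)`); Montvay–Münster (1994) §7.

## What is proved (torus `(ℤ/L)^d`, any group `G`, any representation `ρ : G →* M_N(ℂ)`)

* §1 `stapleUp U x μ ν = U(x+μ̂,ν) U(x+ν̂,μ)⁻¹ U(x,ν)⁻¹`, `stapleDown U x μ ν = U(x−ν̂+μ̂,ν)⁻¹ U(x−ν̂,μ)⁻¹ U(x−ν̂,ν)`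
  (group elements), `plaquetteHolonomy_eq_mul_stapleUp` (`U_{x;μν} = U(x,μ)·A_ν`),
  `conj_plaquetteHolonomy_eq_mul_stapleDown` (the lower plaquette read from `x` is `U(x,μ)·B_ν`),
  `plaquetteHolonomy_comm_eq_inv`; **`stapleSum ρ U x μ = ∑_{ν ≠ μ} (ρ(A_ν) + ρ(B_ν))`** (a matrix).
* §2 **`plaquetteLoopSum_eq_mul_stapleSum`**: for `SU(n)`, Lüscher's `Ω_{x,μ}(V) = V(x,μ) · R_{x,μ}(V)` (fundamental
  `ρ`) — the Wilson-flow velocity is `−P(V_e R_e) V_e`.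
* §3 (`L ≥ 2`) `stapleSum_mulSingle_self`: `R_{x,μ}(h ·_{(x,μ)} U) = R_{x,μ}(U)` — the staple sum does not contain
  its own link (false on the one-site torus, where a plaquette is a commutator).
* §4 (`L ≥ 2`) `plaqOf x μ (ν, b)` enumerates the plaquettes through `(x, μ)` (`plaqThrough_eq_image`,
  `plaqOf_injective`), **`card_plaqThrough`** (`#plaqThrough (x,μ) = 2(d−1)`); for COMPACT `G` and continuous
  `ρ` (then `Re tr ρ(g⁻¹) = Re tr ρ(g)`, the tree's `CompactGroup.re_trace_map_inv` — unitary trick): **`sum_plaqThrough_plaqRe`** (`∑_{p ∋ (x,μ)} Re tr ρ(U_p) = Re tr (ρ(U(x,μ)) R_{x,μ})`),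
  **`linkAction_eq_staple`** (`S_e = 2(d−1)N − Re tr (ρ(U_e) R_e)`), and the exact local action difference
  **`wilsonAction_mulSingle_sub`**: `S_W(h ·_e U) − S_W(U) = Re tr (ρ(U_e) R_e) − Re tr (ρ(h U_e) R_e)` with the
  SAME `R_e = R_e(U)` — the number every local algorithm (Metropolis, heat bath, over-relaxation, cooling) computes.

NOT CLAIMED: `L = 1`; non-compact `G` / discontinuous `ρ` in §4 (there `Re tr ρ(U_p⁻¹) ≠ Re tr ρ(U_p)` in general
and the two orientations of a plaquette must be booked separately); improved (rectangle) actions; anything probabilistic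
(the heat-bath law in the `k ŝ` frame is `Exactness/SU2HeatBathLaw`); any number.  Sequel: `Scoring/SU2Cooling`
(cooling = the exact link-wise minimiser of `S_e`; monotonicity of `S_W` under every cooling schedule; fixed points
versus Wilson-flow stationary points).
-/

noncomputable section

open Matrix
open Literature.MathematicalPhysics.QuantumFieldTheory
open Literature.RepresentationTheory.CompactGroups (CompactGroup.re_trace_map_inv CompactGroup.trace_conj_eq)
open Summit.Ventures.LatticeQCDFlow.TrivializingMaps (plaqLinks plaqThrough linkAction mem_plaqLinks_iff
  mem_plaqThrough_iff wilsonAction_eq_linkAction_add wilsonAction_sub_linkAction_fibre site_shift_ne_self_of_two_le)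

namespace Summit.Ventures.LatticeQCDFlow.Scoring

variable {d L N : ℕ} {G : Type*} [Group G]

/-! ## §1 The two staples through a link and the staple-sum matrix -/

section Staples

/-- The UPPER staple through the link `(x, μ)` in the `(μ, ν)` plane:
`A_ν(U) = U(x+μ̂,ν) · U(x+ν̂,μ)⁻¹ · U(x,ν)⁻¹`, so that the plaquette holonomy at `x` is `U(x,μ) · A_ν`. -/
def stapleUp (U : GaugeConfig d L G) (x : Site d L) (μ ν : Fin d) : G :=
  U (x.shift μ, ν) * (U (x.shift ν, μ))⁻¹ * (U (x, ν))⁻¹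

/-- The LOWER staple through the link `(x, μ)` in the `(μ, ν)` plane:
`B_ν(U) = U(x−ν̂+μ̂,ν)⁻¹ · U(x−ν̂,μ)⁻¹ · U(x−ν̂,ν)`, so that the plaquette at `x − ν̂`, read from `x`, is
`U(x,μ) · B_ν`. -/
def stapleDown (U : GaugeConfig d L G) (x : Site d L) (μ ν : Fin d) : G :=
  (U ((x - Pi.single ν 1).shift μ, ν))⁻¹ * (U (x - Pi.single ν 1, μ))⁻¹ * U (x - Pi.single ν 1, ν)

/-- `U_{x;μν} = U(x,μ) · A_ν`. -/
theorem plaquetteHolonomy_eq_mul_stapleUp (U : GaugeConfig d L G) (x : Site d L) (μ ν : Fin d) :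
    plaquetteHolonomy U x μ ν = U (x, μ) * stapleUp U x μ ν := by
  simp only [plaquetteHolonomy, stapleUp, mul_assoc]

/-- The lower plaquette read from `x`: `U(x−ν̂,ν)⁻¹ · U_{x−ν̂;νμ} · U(x−ν̂,ν) = U(x,μ) · B_ν`. -/
theorem conj_plaquetteHolonomy_eq_mul_stapleDown (U : GaugeConfig d L G) (x : Site d L) (μ ν : Fin d) :
    (U (x - Pi.single ν 1, ν))⁻¹ * plaquetteHolonomy U (x - Pi.single ν 1) ν μ * U (x - Pi.single ν 1, ν) =
      U (x, μ) * stapleDown U x μ ν := by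
  simp only [plaquetteHolonomy, stapleDown, shift_sub_single, mul_assoc, inv_mul_cancel_left]

/-- `U_{x;νμ} = (U_{x;μν})⁻¹`: reversing the orientation of a plaquette inverts its holonomy. -/
theorem plaquetteHolonomy_comm_eq_inv (U : GaugeConfig d L G) (x : Site d L) (μ ν : Fin d) :
    plaquetteHolonomy U x ν μ = (plaquetteHolonomy U x μ ν)⁻¹ := by
  simp only [plaquetteHolonomy, _root_.mul_inv_rev, inv_inv, mul_assoc]

variable (ρ : G →* Matrix (Fin N) (Fin N) ℂ)

/-- **The staple-sum matrix** of the link `(x, μ)` in the representation `ρ`: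
`R_{x,μ}(U) = ∑_{ν ≠ μ} (ρ(A_ν) + ρ(B_ν))`, the sum over the `2(d−1)` staples through the link (for `G = SU(2)` and
the fundamental `ρ` this is the `2 × 2` matrix every local `SU(2)` algorithm — heat bath, over-relaxation,
cooling — starts from; its conjugate transpose is Morningstar–Peardon's `C_μ(x)`). -/
def stapleSum (U : GaugeConfig d L G) (x : Site d L) (μ : Fin d) : Matrix (Fin N) (Fin N) ℂ :=
  ∑ ν ∈ Finset.univ.erase μ, (ρ (stapleUp U x μ ν) + ρ (stapleDown U x μ ν))

/-- Unfolding lemma for `stapleSum`. -/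
theorem stapleSum_def (U : GaugeConfig d L G) (x : Site d L) (μ : Fin d) :
    stapleSum ρ U x μ = ∑ ν ∈ Finset.univ.erase μ, (ρ (stapleUp U x μ ν) + ρ (stapleDown U x μ ν)) := rfl

end Staples

/-! ## §2 Bridge to the Literature Wilson flow: `Ω_{x,μ}(V) = V(x,μ) · R_{x,μ}(V)` -/

section Flow

open Literature.MathematicalPhysics.QuantumLattice (fundamentalRep fundamentalRep_apply)

/-- **`Ω_{x,μ}(V) = V(x,μ) · R_{x,μ}(V)`**: Lüscher's sum of the plaquette loops through a link, oriented to start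
with the link (`plaquetteLoopSum` of `QuantumFieldTheory/WilsonFlow.lean`, the matrix whose projection `−P(Ω)V` is the
Wilson-flow velocity), is the link matrix times the staple-sum matrix in the fundamental representation. -/
theorem plaquetteLoopSum_eq_mul_stapleSum {n : ℕ} (V : GaugeConfig d L (Matrix.specialUnitaryGroup (Fin n) ℂ))
    (x : Site d L) (μ : Fin d) :
    plaquetteLoopSum V x μ =
      ((V (x, μ) : Matrix.specialUnitaryGroup (Fin n) ℂ) : Matrix (Fin n) (Fin n) ℂ) *
        stapleSum (fundamentalRep (Fin n)) V x μ := by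
  rw [stapleSum, Finset.mul_sum, plaquetteLoopSum, ← Finset.sum_erase_add _ _ (Finset.mem_univ μ), if_pos rfl,
    add_zero]
  refine Finset.sum_congr rfl fun ν hν => ?_
  rw [if_neg (Finset.ne_of_mem_erase hν), Matrix.mul_add, fundamentalRep_apply, fundamentalRep_apply,
    plaquetteHolonomy_eq_mul_stapleUp, conj_plaquetteHolonomy_eq_mul_stapleDown,
    WilsonFlow.coe_mul_SU, WilsonFlow.coe_mul_SU]

end Flow

/-! ## §3 The staple sum does not see its own link (`L ≥ 2`) -/

section Fibre

variable [NeZero L]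

/-- `x − ν̂ ≠ x` on a torus of side `L ≥ 2`. -/
theorem sub_single_ne_self (hL : 2 ≤ L) (x : Site d L) (ν : Fin d) : x - Pi.single ν 1 ≠ x := by
  intro h
  have h' := congrArg (fun y : Site d L => y.shift ν) h
  simp only [shift_sub_single] at h'
  exact site_shift_ne_self_of_two_le hL x ν h'.symm

/-- The upper staple through `(x, μ)` does not contain the link `(x, μ)` (`ν ≠ μ`, `L ≥ 2`). -/
theorem stapleUp_mulSingle_self (hL : 2 ≤ L) (U : GaugeConfig d L G) (x : Site d L) {μ ν : Fin d} (hν : ν ≠ μ)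
    (h : G) : stapleUp (Pi.mulSingle (x, μ) h * U) x μ ν = stapleUp U x μ ν := by
  have h1 : ((x.shift μ, ν) : Edge d L) ≠ (x, μ) := fun e => hν (congrArg Prod.snd e)
  have h2 : ((x.shift ν, μ) : Edge d L) ≠ (x, μ) := fun e =>
    site_shift_ne_self_of_two_le hL x ν (congrArg Prod.fst e)
  have h3 : ((x, ν) : Edge d L) ≠ (x, μ) := fun e => hν (congrArg Prod.snd e)
  simp only [stapleUp, Pi.mul_apply, Pi.mulSingle_eq_of_ne h1, Pi.mulSingle_eq_of_ne h2,
    Pi.mulSingle_eq_of_ne h3, one_mul]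

/-- The lower staple through `(x, μ)` does not contain the link `(x, μ)` (`ν ≠ μ`, `L ≥ 2`). -/
theorem stapleDown_mulSingle_self (hL : 2 ≤ L) (U : GaugeConfig d L G) (x : Site d L) {μ ν : Fin d} (hν : ν ≠ μ)
    (h : G) : stapleDown (Pi.mulSingle (x, μ) h * U) x μ ν = stapleDown U x μ ν := by
  have h1 : (((x - Pi.single ν 1).shift μ, ν) : Edge d L) ≠ (x, μ) := fun e => hν (congrArg Prod.snd e)
  have h2 : ((x - Pi.single ν 1, μ) : Edge d L) ≠ (x, μ) := fun e =>
    sub_single_ne_self hL x ν (congrArg Prod.fst e)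
  have h3 : ((x - Pi.single ν 1, ν) : Edge d L) ≠ (x, μ) := fun e => hν (congrArg Prod.snd e)
  simp only [stapleDown, Pi.mul_apply, Pi.mulSingle_eq_of_ne h1, Pi.mulSingle_eq_of_ne h2,
    Pi.mulSingle_eq_of_ne h3, one_mul]

variable (ρ : G →* Matrix (Fin N) (Fin N) ℂ)

/-- **The staple sum is constant along the fibre of its own link**: replacing `U(x,μ)` by `h · U(x,μ)` does not
change `R_{x,μ}` (`L ≥ 2`; on the one-site torus `L = 1` a plaquette is a commutator and this fails). -/
theorem stapleSum_mulSingle_self (hL : 2 ≤ L) (U : GaugeConfig d L G) (x : Site d L) (μ : Fin d) (h : G) :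
    stapleSum ρ (Pi.mulSingle (x, μ) h * U) x μ = stapleSum ρ U x μ := by
  refine Finset.sum_congr rfl fun ν hν => ?_
  rw [stapleUp_mulSingle_self hL U x (Finset.ne_of_mem_erase hν), stapleDown_mulSingle_self hL U x
    (Finset.ne_of_mem_erase hν)]

omit [NeZero L] in
/-- The new link after the fibre move: `(h ·_{(x,μ)} U)(x,μ) = h · U(x,μ)`. -/
theorem mulSingle_mul_apply_self (U : GaugeConfig d L G) (e : Edge d L) (h : G) :
    (Pi.mulSingle e h * U : GaugeConfig d L G) e = h * U e := by
  rw [Pi.mul_apply, Pi.mulSingle_eq_same]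

omit [NeZero L] in
/-- Off the moved link nothing changes: `(h ·_e U)(e') = U(e')` for `e' ≠ e`. -/
theorem mulSingle_mul_apply_of_ne (U : GaugeConfig d L G) {e e' : Edge d L} (he : e' ≠ e) (h : G) :
    (Pi.mulSingle e h * U : GaugeConfig d L G) e' = U e' := by
  rw [Pi.mul_apply, Pi.mulSingle_eq_of_ne he, one_mul]

end Fibre

/-! ## §4 The `2(d−1)` plaquettes through a link, and the link action in staple form -/

section Through

variable [NeZero L]

/-- The ordered plane index `{μ, ν}` of `Plaquette d L` (smaller direction first), for `μ ≠ ν`. -/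
def plane (μ ν : Fin d) (h : μ ≠ ν) : {q : Fin d × Fin d // q.1 < q.2} :=
  if hlt : μ < ν then ⟨(μ, ν), hlt⟩ else ⟨(ν, μ), lt_of_le_of_ne (not_lt.mp hlt) h.symm⟩

omit [NeZero L] in
/-- `plane` is symmetric. -/
theorem plane_comm {μ ν : Fin d} (h : μ ≠ ν) : plane μ ν h = plane ν μ h.symm := by
  unfold plane
  by_cases hlt : μ < ν
  · rw [dif_pos hlt, dif_neg (not_lt.mpr hlt.le)]
  · rw [dif_neg hlt, dif_pos (lt_of_le_of_ne (not_lt.mp hlt) h.symm)]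

omit [NeZero L] in
/-- `plane μ ·` is injective. -/
theorem plane_injective {μ ν ν' : Fin d} (h : μ ≠ ν) (h' : μ ≠ ν') (e : plane μ ν h = plane μ ν' h') :
    ν = ν' := by
  unfold plane at e
  split_ifs at e with h1 h2 h2 <;> simp only [Subtype.mk.injEq, Prod.mk.injEq] at e
  · exact e.2
  · exact absurd e.2.symm h
  · exact absurd e.1.symm h
  · exact e.1

/-- The plaquette through `(x, μ)` in the plane `ν ≠ μ`: the UPPER one (based at `x`) for `b = true`, the LOWER
one (based at `x − ν̂`) for `b = false`. -/
def plaqOf (x : Site d L) (μ : Fin d) (νb : {ν : Fin d // ν ≠ μ} × Bool) : Plaquette d L :=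
  (if νb.2 then x else x - Pi.single (νb.1 : Fin d) 1, plane μ νb.1 (fun h => νb.1.2 h.symm))

variable [TopologicalSpace G] [IsTopologicalGroup G] [CompactSpace G] (ρ : G →* Matrix (Fin N) (Fin N) ℂ)

omit [NeZero L] in
/-- `Re tr ρ` of the plaquette at `y` in the plane `{μ, ν}` is `Re tr ρ(U_{y;μν})` in either orientation
(compact `G`, continuous `ρ`: `Re tr ρ(g⁻¹) = Re tr ρ(g)` by the unitary trick, `CompactGroup.re_trace_map_inv`). -/
theorem plaqRe_plane (hρ : Continuous ρ) (U : GaugeConfig d L G) (y : Site d L)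
    {μ ν : Fin d} (h : μ ≠ ν) :
    WilsonRP.plaqRe ρ U (y, plane μ ν h) = (ρ (plaquetteHolonomy U y μ ν)).trace.re := by
  unfold plane
  split_ifs with hlt
  · rfl
  · show (ρ (plaquetteHolonomy U y ν μ)).trace.re = _
    rw [plaquetteHolonomy_comm_eq_inv, CompactGroup.re_trace_map_inv ρ hρ]

omit [NeZero L] in
/-- The upper plaquette through `(x, μ)` in the plane `ν` contributes `Re tr (ρ(U(x,μ)) ρ(A_ν))`. -/
theorem plaqRe_plaqOf_true (hρ : Continuous ρ) (U : GaugeConfig d L G)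
    (x : Site d L) (μ : Fin d) (ν : {ν : Fin d // ν ≠ μ}) :
    WilsonRP.plaqRe ρ U (plaqOf x μ (ν, true)) = (ρ (U (x, μ)) * ρ (stapleUp U x μ ν)).trace.re := by
  simp only [plaqOf, ↓reduceIte]
  rw [plaqRe_plane ρ hρ, plaquetteHolonomy_eq_mul_stapleUp, map_mul]

omit [NeZero L] in
/-- The lower plaquette through `(x, μ)` in the plane `ν` contributes `Re tr (ρ(U(x,μ)) ρ(B_ν))`. -/
theorem plaqRe_plaqOf_false (hρ : Continuous ρ) (U : GaugeConfig d L G)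
    (x : Site d L) (μ : Fin d) (ν : {ν : Fin d // ν ≠ μ}) :
    WilsonRP.plaqRe ρ U (plaqOf x μ (ν, false)) = (ρ (U (x, μ)) * ρ (stapleDown U x μ ν)).trace.re := by
  simp only [plaqOf, Bool.false_eq_true, ↓reduceIte]
  rw [plane_comm, plaqRe_plane ρ hρ,
    ← CompactGroup.trace_conj_eq ρ (plaquetteHolonomy U (x - Pi.single (ν : Fin d) 1) ν μ)
      (U (x - Pi.single (ν : Fin d) 1, (ν : Fin d)))⁻¹,
    inv_inv, conj_plaquetteHolonomy_eq_mul_stapleDown, map_mul]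

omit [NeZero L] in
/-- Each `plaqOf x μ (ν, b)` is a plaquette through `(x, μ)`. -/
theorem mem_plaqLinks_plaqOf (x : Site d L) (μ : Fin d) (νb : {ν : Fin d // ν ≠ μ} × Bool) :
    ((x, μ) : Edge d L) ∈ plaqLinks (plaqOf x μ νb) := by
  rw [mem_plaqLinks_iff]
  obtain ⟨⟨ν, hν⟩, b⟩ := νb
  cases b
  · by_cases hlt : μ < ν
    · simp only [plaqOf, plane, dif_pos hlt, Bool.false_eq_true, ↓reduceIte]
      exact Or.inr (Or.inr (Or.inl (by rw [shift_sub_single])))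
    · simp only [plaqOf, plane, dif_neg hlt, Bool.false_eq_true, ↓reduceIte]
      exact Or.inr (Or.inl (by rw [shift_sub_single]))
  · by_cases hlt : μ < ν
    · simp only [plaqOf, plane, dif_pos hlt, ↓reduceIte, true_or]
    · simp only [plaqOf, plane, dif_neg hlt, ↓reduceIte, or_true]

/-- Conversely every plaquette through `(x, μ)` is some `plaqOf x μ (ν, b)` (a four-case check on the position
of the link in the plaquette). -/
theorem exists_plaqOf_eq {x : Site d L} {μ : Fin d} {p : Plaquette d L} (hp : p ∈ plaqThrough (x, μ)) :
    ∃ νb, plaqOf x μ νb = p := by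
  obtain ⟨y, ⟨i, j⟩, hij⟩ := p
  simp only [mem_plaqThrough_iff, mem_plaqLinks_iff, Prod.mk.injEq] at hp
  simp only at hij
  rcases hp with ⟨hx, hμ⟩ | ⟨hx, hμ⟩ | ⟨hx, hμ⟩ | ⟨hx, hμ⟩ <;> subst hμ
  · refine ⟨(⟨j, hij.ne'⟩, true), ?_⟩
    simp only [plaqOf, plane, dif_pos hij, ↓reduceIte, hx]
  · refine ⟨(⟨i, hij.ne⟩, false), ?_⟩
    simp only [plaqOf, plane, dif_neg (not_lt.mpr hij.le), Bool.false_eq_true, ↓reduceIte, hx,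
      WilsonFlow.shift_sub_self]
  · refine ⟨(⟨j, hij.ne'⟩, false), ?_⟩
    simp only [plaqOf, plane, dif_pos hij, Bool.false_eq_true, ↓reduceIte, hx, WilsonFlow.shift_sub_self]
  · refine ⟨(⟨i, hij.ne⟩, true), ?_⟩
    simp only [plaqOf, plane, dif_neg (not_lt.mpr hij.le), ↓reduceIte, hx]

/-- **The plaquettes through `(x, μ)` are exactly the `plaqOf x μ (ν, b)`, `ν ≠ μ`, `b ∈ {upper, lower}`.** -/
theorem plaqThrough_eq_image (x : Site d L) (μ : Fin d) :
    plaqThrough (x, μ) = Finset.univ.image (plaqOf x μ) := by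
  ext p
  constructor
  · intro hp
    obtain ⟨νb, rfl⟩ := exists_plaqOf_eq hp
    exact Finset.mem_image_of_mem _ (Finset.mem_univ _)
  · intro hp
    obtain ⟨νb, -, rfl⟩ := Finset.mem_image.mp hp
    exact (mem_plaqThrough_iff _ _).mpr (mem_plaqLinks_plaqOf x μ νb)

/-- On a torus of side `L ≥ 2` the `plaqOf x μ (ν, b)` are pairwise distinct. -/
theorem plaqOf_injective (hL : 2 ≤ L) (x : Site d L) (μ : Fin d) : Function.Injective (plaqOf x μ) := by
  rintro ⟨⟨ν, hν⟩, b⟩ ⟨⟨ν', hν'⟩, b'⟩ h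
  simp only [plaqOf, Prod.mk.injEq] at h
  obtain ⟨hsite, hplane⟩ := h
  obtain rfl : ν = ν' := plane_injective _ _ hplane
  have hb : b = b' := by
    cases b <;> cases b' <;> simp only [Bool.false_eq_true, ↓reduceIte] at hsite
    · rfl
    · exact absurd hsite (sub_single_ne_self hL x ν)
    · exact absurd hsite.symm (sub_single_ne_self hL x ν)
    · rfl
  subst hb
  rfl

/-- **`#plaqThrough e = 2(d−1)`** for `L ≥ 2` (the exact count that `WilsonLinkLocality` left open). -/
theorem card_plaqThrough (hL : 2 ≤ L) (x : Site d L) (μ : Fin d) : (plaqThrough (x, μ)).card = 2 * (d - 1) := by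
  rw [plaqThrough_eq_image, Finset.card_image_of_injective _ (plaqOf_injective hL x μ), Finset.card_univ,
    Fintype.card_prod, Fintype.card_bool, Fintype.card_subtype, Finset.filter_ne',
    Finset.card_erase_of_mem (Finset.mem_univ μ), Finset.card_univ, Fintype.card_fin, mul_comm]

/-- **The link-local Wilson action in staple form**: for `L ≥ 2`, compact `G` and continuous `ρ`,
`∑_{p ∋ (x,μ)} Re tr ρ(U_p) = Re tr (ρ(U(x,μ)) · R_{x,μ}(U))`. -/
theorem sum_plaqThrough_plaqRe (hL : 2 ≤ L) (hρ : Continuous ρ)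
    (U : GaugeConfig d L G) (x : Site d L) (μ : Fin d) :
    ∑ p ∈ plaqThrough (x, μ), WilsonRP.plaqRe ρ U p = ((ρ (U (x, μ)) * stapleSum ρ U x μ).trace).re := by
  rw [plaqThrough_eq_image, Finset.sum_image fun a _ b _ h => plaqOf_injective hL x μ h, Fintype.sum_prod_type]
  simp_rw [Fintype.sum_bool, plaqRe_plaqOf_true ρ hρ, plaqRe_plaqOf_false ρ hρ]
  rw [stapleSum, Finset.mul_sum, Matrix.trace_sum, Complex.re_sum,
    Finset.sum_subtype (Finset.univ.erase μ) (p := fun ν => ν ≠ μ)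
      (fun ν => by rw [Finset.mem_erase, and_iff_left (Finset.mem_univ ν)])]
  refine Finset.sum_congr rfl fun ν _ => ?_
  rw [Matrix.mul_add, Matrix.trace_add, Complex.add_re]

/-- **`S_e(U) = 2(d−1)N − Re tr (ρ(U_e) R_e(U))`**: the link-local part `linkAction` of the Wilson action
(`WilsonLinkLocality`) in staple form (`L ≥ 2`, compact `G`, continuous `ρ`). -/
theorem linkAction_eq_staple (hL : 2 ≤ L) (hρ : Continuous ρ)
    (U : GaugeConfig d L G) (x : Site d L) (μ : Fin d) :
    linkAction ρ (x, μ) U = 2 * ((d - 1 : ℕ) : ℝ) * N - ((ρ (U (x, μ)) * stapleSum ρ U x μ).trace).re := by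
  rw [linkAction, Finset.sum_sub_distrib, Finset.sum_const, card_plaqThrough hL, nsmul_eq_mul,
    sum_plaqThrough_plaqRe ρ hL hρ]
  push_cast
  ring

/-- **The exact local action difference.**  Replacing the link `U(x,μ)` by `h · U(x,μ)` changes the Wilson
action by `S_W(h ·_e U) − S_W(U) = Re tr (ρ(U_e) R_e) − Re tr (ρ(h U_e) R_e)` with the SAME staple sum `R_e = R_e(U)`
— the quantity every local algorithm (Metropolis, heat bath, over-relaxation, cooling) evaluates (`L ≥ 2`, compact
`G`, continuous `ρ`). -/
theorem wilsonAction_mulSingle_sub (hL : 2 ≤ L) (hρ : Continuous ρ)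
    (U : GaugeConfig d L G) (x : Site d L) (μ : Fin d) (h : G) :
    wilsonAction ρ (Pi.mulSingle (x, μ) h * U) - wilsonAction ρ U =
      ((ρ (U (x, μ)) * stapleSum ρ U x μ).trace).re - ((ρ (h * U (x, μ)) * stapleSum ρ U x μ).trace).re := by
  have hf := wilsonAction_sub_linkAction_fibre ρ (x, μ) h U
  rw [linkAction_eq_staple ρ hL hρ, linkAction_eq_staple ρ hL hρ, stapleSum_mulSingle_self ρ hL,
    mulSingle_mul_apply_self] at hf
  linarith

end Through

end Summit.Ventures.LatticeQCDFlow.Scoring
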